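import Summits.CriticalPhenomena.Ising3DConformalLimit.Theses.PositivityBegetsConformality
import Summits.CriticalPhenomena.Ising3DConformalLimit.Theses.HyperoctahedralRP
import Summits.CriticalPhenomena.Ising3DConformalLimit.Theorems.PerfectScreeningMoebiusLimitExistsInversionPositive
import Summits.CriticalPhenomena.Ising3DConformalLimit.Theorems.PerfectScreeningMoebiusLimitExistsSketchReduction
import Summits.CriticalPhenomena.Ising3DConformalLimit.Theorems.PlantedPinningMoebiusLimitExistsWardDoorTight
import Summits.CriticalPhenomena.Ising3DConformalLimit.Theorems.LeeYangGapMoebiusLimitExistsLatticeWardDoor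
import Summits.CriticalPhenomena.Ising3DConformalLimit.Theorems.PositivityBegetsConformalityInversionPositiveLimitWitness
import Summits.CriticalPhenomena.Ising3DConformalLimit.Theorems.PositivityBegetsConformalityInversionPositiveLimitLevelFour
import Literature.Probability.LatticeModels.CriticalWickDichotomy
import Literature.Probability.LatticeModels.InversionPositivity
import HarnessLib
import HarnessLib.Audit

/-!
# Skeleton (RESHAPED, lead cycles c1 + c3; readings c5 + c6) for crux `InversionPositiveLimit` — item stmt-CriticalPhenomena-4671,
# route `PositivityBegetsConformality` (rank 2), sub-problem `Ising3DConformalLimit`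

Registered file `Cruxes/InversionPositiveLimit/Lines/birth.lean` (planner birth certificate 2026-08-17,
reshaped by lead `prover-line-stmt-CriticalPhenomena-4671-c1-0` (single stub = item 1982 by name) and by lead
`prover-line-stmt-CriticalPhenomena-4671-c3-0` (2026-08-17: case split along the Gaussian dichotomy — STUB A, the
Gaussian locus of the crux, PROVED this seat in `Theorems/PositivityBegetsConformalityInversionPositiveLimitStrata.lean`;
STUB 1 = item 1982 by name is needed only on the interacting stratum `HasNontrivialU4 S`).

THE CRUX (by name `PositivityBegetsConformality.InversionPositiveLimit`): every normalised, non-degenerate,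
translation-invariant, scale-covariant (dimension `Δ`) pointwise scaling limit `S` of `criticalCorr 3` is
inversion POSITIVE with weight `Δ` — all radial Osterwalder–Schrader Gram matrices
`M_ab = (∏ᵢ ‖X_b i‖^(−2Δ)) · S_(k_a+k_b)(X_a ⊔ ιX_b)` over admissible families are `Matrix.PosSemidef`.

WHY THE RESHAPE. The birth certificate split the crux EXACTLY as
`crux ↔ STUB 1 ∧ STUB 2` with STUB 1 = item stmt-1982 `HyperoctahedralRP.InversionUpgradeNormalised`
(the symmetry half = Polyakov's inversion upgrade) and STUB 2 = lattice radial OS positivity (the form half).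
Since then the tree acquired the KERNEL-CHECKED equivalence
`MoebiusLimitExistsInversionPositive.inversionPositiveLimit_iff_inversionUpgradeNormalised`
(Theorems/PerfectScreeningMoebiusLimitExistsInversionPositive.lean, p141302; engine: the pointwise Mack
converse p141042 — Möbius covariance + OS positivity along one axis ⇒ inversion positivity — fed by the
landed plane reflection positivity of Ising₃ limits `stub_osReflectionPositive ∘ stub_latticeRP`, their
O(3) invariance (items 1979/1980) and permutation symmetry).  So **crux 4671 ⟺ item 1982**, STUB 2 is
implied by STUB 1, and the former STUB 2 is discharged below modulo STUB 1 (`latticeRadialPositivity_of_stub`,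
sorry-free given the stub) and is no longer registered.

c3 RESHAPE (Gaussian dichotomy).  By Newman's Lee–Yang dichotomy for limits of `criticalCorr 3`
(`HasPointwiseScalingLimit.eq_pairingSum_of_limitConnectedFour_eq_zero`) an admissible limit is either Wick at
all orders (`¬ HasNontrivialU4 S`, the Gaussian locus) or interacting (`HasNontrivialU4 S`).  On the Gaussian
locus the crux is PROVED (STUB A `stub_gaussianLocusPositive`, landed this seat: Wick families are inversion
covariant, `gaussianFamilyInversionCovariant`, and covariance gives positivity by Mack's converse,
`isInversionPositive_of_limit`); on the interacting stratum the crux is STUB 1 (item 1982 by name) through the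
same converse.  Registered stubs: `stub_gaussianLocusPositive` (closed, p148112), `stub_inversionUpgradeNormalised` (open).

COMPOSITION (`InversionPositiveLimit_of`, no `sorry`): `by_cases HasNontrivialU4 S` — interacting: STUB 1 fed to
`isInversionPositive_of_limit` (isotropy by `isRotationInvariant_of_scaleCovariantLimit`); Gaussian: STUB A.
`InversionPositiveLimit_of_stubs` instantiates it with the stubs — the crux BY NAME.  EXACTNESS: `crux_iff_stub` (the landed iff), and the finer reading
`crux_iff_interior` — by `…SketchReduction.inversionUpgradeNormalised_iff_interior` the crux is equally the
(strict form of the) residual stub `stub_interiorInversionUpgrade` of item 1982's live line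
`free-endpoint-gaussian-closure` (window `1/2 < Δ ≤ 3/4`, `HasNontrivialU4`, pointwise OS reconstruction along every axis, clustering
along rays ⇒ inversion covariance).

WHAT REMAINS: item stmt-1982 itself (open problem: conformal invariance of the Ising₃ scaling limit,
Duminil-Copin ICM 2022 §8.4; wanted by 13 routes; crux chain `Cruxes/InversionUpgradeNormalised`).  This
line delegates to it and does not re-enter it.

c5 (lead `prover-line-stmt-CriticalPhenomena-4671-c5-0`, 2026-08-17): no reshape (1 stub = item 1982 by name).
Added the third exact reading of the residue, through the landed Ward door (p149203,
`MoebiusLimitExistsWardDoor.inversionUpgradeNormalised_iff_wardUpgrade`): the crux ⟺ the bare weak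
special-conformal WARD UPGRADE (`crux_iff_wardUpgrade`) — every normalised non-degenerate Euclidean
scale-covariant pointwise limit of `criticalCorr 3` satisfies `∀ n, SCTWardWeak S Δ n`; and landed the
positivity-half tightness of the crux (`Theorems/InversionPositiveLimit/Negative/UnitarityBound.lean`:
unitarity bound `Δ = 0 ∨ Δ ≥ 1/2` for inversion-positive families, `gffFamily Δ` Möbius covariant yet not
inversion positive for `0 < Δ < 1/2`, the lattice clause load-bearing on both sides of `Δ = 1/2`).

c6 (lead `prover-line-stmt-CriticalPhenomena-4671-c6-0`, 2026-08-17): no reshape (1 stub = item 1982 by name; wave: none).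
Added the fourth exact reading of the residue, through the landed LATTICE Ward door (p152646,
`MoebiusLimitExistsLatticeWard.inversionUpgradeNormalised_iff_latticeWardUpgrade'`): the crux ⟺ the asymptotic
special-conformal Ward identities OF THE RESCALED LATTICE CORRELATORS themselves (`crux_iff_latticeWardUpgrade`) —
for every `(ρ, Δ)` under which `criticalCorr 3` has a normalised non-degenerate Euclidean `Δ`-covariant pointwise limit,
`∫ ρ(δ)ⁿ ⟨σ_[x₁/δ] ⋯ σ_[xₙ/δ]⟩⁺_{β_c} (𝒦ᵀ_b φ)(x) dx → 0` as `δ → 0⁺` for every smooth `φ` compactly supported off the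
diagonals; no limit object occurs in the conclusion.  This is the form a lattice mechanism (discrete conformal Ward
identity / lattice stress tensor on `ℤ³`) would have to deliver; none is known (Duminil-Copin ICM 2022 §8.4).

Also landed this seat (p154188, `Theorems/PositivityBegetsConformalityInversionPositiveLimitWitness.lean`,
`--supports 4671`): the WITNESS REDUCTION `crux_iff_exists` — the `∀ (ρ, Δ, S)` of the crux is idle: inversion
positivity transports along the `cⁿ`-orbit of non-degenerate limits (`isInversionPositive_transport`), so the crux is
equivalent to "item 1981 ⇒ SOME admissible limit is inversion positive" (and holds vacuously without item 1981).

And (p155575 + p155847, `Theorems/PositivityBegetsConformalityInversionPositiveLimit{LevelwiseMack,LevelFour}.lean`,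
`--supports 4671`): the crux's FIRST LEVEL WITH CONTENT is pinned — item stmt-4672 `FourPointConeMembership` (the
landed consequence `crux ⇒ 4672`, p148112) ⟺ the LEVEL-4 inversion upgrade `S₄(ιx) = ∏ᵢ‖xᵢ‖^{2Δ} S₄(x)` of
admissible limits (`crux_levelFour` below): a levelwise Mack converse (`⇐`) and, for `⇒`, Gram SYMMETRY at
sphere-separated 2|2 configurations propagated to all configurations by permutation symmetry, scale covariance
and CONTINUITY of `S₄` alone (no analyticity).

Sorries: exactly one, inside `stub_inversionUpgradeNormalised` (STUB A is the landed theorem, p148112).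
-/

noncomputable section

namespace Summit.CriticalPhenomena.Ising3DConformalLimit.Cruxes.InversionPositiveLimit.Birth

open Filter Topology
open Literature.Probability.LatticeModels EuclideanGeometry
open Summit.CriticalPhenomena.Ising3DConformalLimit.Theses
open Summit.CriticalPhenomena.Ising3DConformalLimit.MoebiusLimitExistsInversionPositive
  (isInversionPositive_of_limit inversionPositiveLimit_of_inversionUpgradeNormalised
    inversionPositiveLimit_iff_inversionUpgradeNormalised)
open Summit.CriticalPhenomena.Ising3DConformalLimit.MoebiusLimitExistsTwoLeaf
  (isRotationInvariant_of_scaleCovariantLimit)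
open Summit.CriticalPhenomena.Ising3DConformalLimit.MoebiusLimitExistsSketch
  (inversionUpgradeNormalised_iff_interiorStrict gaussianFamilyInversionCovariant)

/-! ## The registered stubs -/

/-- **STUB A — the Gaussian locus of the crux (LANDED p148112, lead c3;
`Theorems/PositivityBegetsConformalityInversionPositiveLimitStrata.lean`; kept here by name, no `sorry`).** Every normalised, non-degenerate,
translation-invariant, scale-covariant pointwise scaling limit `S` of `criticalCorr 3` with `U₄ ≡ 0` on
non-coincident configurations is inversion positive with weight `Δ`: odd orders vanish, Wick's rule holds at
all even orders (Newman's dichotomy), Wick families are inversion covariant (`gaussianFamilyInversionCovariant`)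
and covariance gives positivity (`isInversionPositive_of_limit`, Mack's converse over the landed plane RP and
isotropy of such limits). [folklore] -/
theorem stub_gaussianLocusPositive :
    ∀ (ρ : ℝ → ℝ) (Δ : ℝ) (S : CorrFamily 3), (∀ δ ∈ Set.Ioc (0:ℝ) 1, 0 < ρ δ) →
      HasPointwiseScalingLimit (criticalCorr 3) ρ S → (∀ n z, z ∉ NonCoincident 3 n → S n z = 0) →
      IsNondegenerateTwoPoint S → IsTranslationInvariant S → IsScaleCovariant Δ S →
      ¬ HasNontrivialU4 S → IsInversionPositive Δ S := by
  -- LANDED (p148112) as `…PositivityBegetsConformalityInversionPositiveLimit.stub_gaussianLocusPositive` in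
  -- Theorems/PositivityBegetsConformalityInversionPositiveLimitStrata.lean; the proof is repeated verbatim here so that
  -- this workfile elaborates independently of the farm's build of that module.
  intro ρ Δ S hρ hlim hnorm hnd htr hsc hU4
  have hrot : IsRotationInvariant S := isRotationInvariant_of_scaleCovariantLimit hρ hlim hnorm hnd htr hsc
  have hodd : ∀ n (x : Fin n → EuclideanSpace ℝ (Fin 3)), Odd n → S n x = 0 := by
    intro n x hn
    by_cases hx : x ∈ NonCoincident 3 n
    · exact hlim.eq_zero_of_odd le_rfl hn hx
    · exact hnorm n x hx
  have hU : ∀ z ∈ NonCoincident 3 4, limitConnectedFour S z = 0 := by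
    intro z hz
    by_contra hne
    exact hU4 ⟨z, hz, hne⟩
  have hwick : ∀ n, 2 ≤ n → ∀ x ∈ NonCoincident 3 (2 * n),
      S (2 * n) x = pairingSum (fun p q => S 2 ![p, q]) n x :=
    fun n hn x hx => hlim.eq_pairingSum_of_limitConnectedFour_eq_zero le_rfl hU hn hx
  exact isInversionPositive_of_limit hρ hlim hnorm hnd htr hsc
    (gaussianFamilyInversionCovariant hnorm ⟨htr, hrot⟩ hsc hodd hwick)


/-- **STUB 1 — the inversion upgrade, item stmt-CriticalPhenomena-1982 BY NAME
(`HyperoctahedralRP.InversionUpgradeNormalised`).** Every pointwise scaling limit `S` of `criticalCorr 3`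
(`ρ > 0` on `(0,1]`) that is normalised, non-degenerate, Euclidean invariant and scale covariant with `Δ` is
inversion covariant with the same `Δ` (Polyakov's postulate for Ising₃; PolandRychkovVichi2019 §II eq. (2)).
Needed by the composition ONLY on the interacting stratum `HasNontrivialU4 S` (STUB A covers the rest).
The model-blind statement is FALSE (free Maxwell field in `d = 3`, El-Showk–Nakayama–Rychkov 2011; tree barrier
`ScaleCovarianceNotMoebius`), so a proof must use the Ising hypothesis.  Open; crux chain of item 1982
(`Cruxes/InversionUpgradeNormalised`, line `free-endpoint-gaussian-closure` 6/7, residue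
`stub_interiorInversionUpgrade`).  Closes by `h1982` the day item 1982 lands.
[cite: PolandRychkovVichi2019, §II eq. (2)] -/
theorem stub_inversionUpgradeNormalised :
    Summit.CriticalPhenomena.Ising3DConformalLimit.Theses.HyperoctahedralRP.InversionUpgradeNormalised := by
  sorry

/-! ## The composition -/

/-- **THE SKELETON THEOREM** — `InversionPositiveLimit` from the stubs, by the Gaussian dichotomy: on the
interacting stratum STUB 1 (the inversion upgrade) fed to Mack's converse over the landed plane reflection
positivity and isotropy of Ising₃ limits (`isInversionPositive_of_limit`); on the Gaussian locus STUB A.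
[cite: LuscherMack1975, §2–§3] -/
theorem InversionPositiveLimit_of
    (hA : ∀ (ρ : ℝ → ℝ) (Δ : ℝ) (S : CorrFamily 3), (∀ δ ∈ Set.Ioc (0:ℝ) 1, 0 < ρ δ) →
      HasPointwiseScalingLimit (criticalCorr 3) ρ S → (∀ n z, z ∉ NonCoincident 3 n → S n z = 0) →
      IsNondegenerateTwoPoint S → IsTranslationInvariant S → IsScaleCovariant Δ S →
      ¬ HasNontrivialU4 S → IsInversionPositive Δ S)
    (h₁ : Summit.CriticalPhenomena.Ising3DConformalLimit.Theses.HyperoctahedralRP.InversionUpgradeNormalised) :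
    Summit.CriticalPhenomena.Ising3DConformalLimit.Theses.PositivityBegetsConformality.InversionPositiveLimit := by
  intro ρ Δ S hρ hlim hnorm hnd htr hsc
  by_cases hU4 : HasNontrivialU4 S
  · exact isInversionPositive_of_limit hρ hlim hnorm hnd htr hsc
      (h₁ ρ Δ S hρ hlim hnorm hnd ⟨htr, isRotationInvariant_of_scaleCovariantLimit hρ hlim hnorm hnd htr hsc⟩ hsc)
  · exact hA ρ Δ S hρ hlim hnorm hnd htr hsc hU4

/-- The crux BY NAME from the registered stubs. [folklore] -/
theorem InversionPositiveLimit_of_stubs :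
    Summit.CriticalPhenomena.Ising3DConformalLimit.Theses.PositivityBegetsConformality.InversionPositiveLimit :=
  InversionPositiveLimit_of stub_gaussianLocusPositive stub_inversionUpgradeNormalised

/-- The single-stub composition of the c1 reshape remains valid: STUB 1 alone gives the crux (the landed
`inversionPositiveLimit_of_inversionUpgradeNormalised`); STUB A only records which stratum is closed.
[cite: LuscherMack1975, §2–§3] -/
theorem InversionPositiveLimit_of_stub1
    (h₁ : Summit.CriticalPhenomena.Ising3DConformalLimit.Theses.HyperoctahedralRP.InversionUpgradeNormalised) :
    Summit.CriticalPhenomena.Ising3DConformalLimit.Theses.PositivityBegetsConformality.InversionPositiveLimit :=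
  inversionPositiveLimit_of_inversionUpgradeNormalised h₁

/-! ## Exactness of the reshaped split (information, sorry-free) -/

/-- **The split is exact**: the crux is EQUIVALENT to its single stub (item 1982) — the landed
`inversionPositiveLimit_iff_inversionUpgradeNormalised`. [cite: LuscherMack1975, §2–§3] -/
theorem crux_iff_stub :
    Summit.CriticalPhenomena.Ising3DConformalLimit.Theses.PositivityBegetsConformality.InversionPositiveLimit ↔
      Summit.CriticalPhenomena.Ising3DConformalLimit.Theses.HyperoctahedralRP.InversionUpgradeNormalised :=
  inversionPositiveLimit_iff_inversionUpgradeNormalised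

/-- **Finer reading of what remains**: the crux is equivalent to the residual stub of item 1982's live
line in its strict form — the inversion upgrade on the window `1/2 < Δ ≤ 3/4` for limits with non-trivial
`U₄`, pointwise OS reconstruction along every axis and clustering along rays
(`inversionUpgradeNormalised_iff_interiorStrict`,
Theorems/PerfectScreeningMoebiusLimitExistsSketchReduction.lean). [folklore] -/
theorem crux_iff_interior :
    Summit.CriticalPhenomena.Ising3DConformalLimit.Theses.PositivityBegetsConformality.InversionPositiveLimit ↔
      (∀ (ρ : ℝ → ℝ) (Δ : ℝ) (S : CorrFamily 3), (∀ δ ∈ Set.Ioc (0:ℝ) 1, 0 < ρ δ) →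
        HasPointwiseScalingLimit (criticalCorr 3) ρ S → (∀ n z, z ∉ NonCoincident 3 n → S n z = 0) →
        IsNondegenerateTwoPoint S → IsEuclideanInvariant S → IsScaleCovariant Δ S → 1 / 2 < Δ → Δ ≤ 3 / 4 →
        HasNontrivialU4 S →
        (∀ τ : Fin 3, Literature.MathematicalPhysics.QuantumFieldTheory.PointwiseOSReconstruction τ S) →
        (∀ (n m : ℕ) (x : Fin n → EuclideanSpace ℝ (Fin 3)) (y : Fin m → EuclideanSpace ℝ (Fin 3))
          (v : EuclideanSpace ℝ (Fin 3)), v ≠ 0 →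
          Tendsto (fun t : ℝ => S (n + m) (Fin.append x (fun j => y j + t • v)) - S n x * S m y) atTop (𝓝 0)) →
        IsInversionCovariant Δ S) :=
  inversionPositiveLimit_iff_inversionUpgradeNormalised.trans inversionUpgradeNormalised_iff_interiorStrict

/-- **Third reading of what remains (c5): the Ward door.** The crux is equivalent to the bare weak
special-conformal Ward upgrade for Ising₃ limits — every normalised, non-degenerate, Euclidean-invariant,
scale-covariant pointwise limit of `criticalCorr 3` satisfies the weak SCT Ward identities
`∀ n, SCTWardWeak S Δ n` (the local, linear form a lattice Ward identity / discrete stress tensor would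
deliver) — by `crux_iff_stub` and the landed TIGHT Ward door
`MoebiusLimitExistsWardDoor.inversionUpgradeNormalised_iff_wardUpgrade` (p149203).
[cite: FrancescoMathieuSenechal1997, §4.3.1 eq. (4.62)] -/
theorem crux_iff_wardUpgrade :
    Summit.CriticalPhenomena.Ising3DConformalLimit.Theses.PositivityBegetsConformality.InversionPositiveLimit ↔
      (∀ (ρ : ℝ → ℝ) (Δ : ℝ) (S : CorrFamily 3), (∀ δ ∈ Set.Ioc (0:ℝ) 1, 0 < ρ δ) →
        HasPointwiseScalingLimit (criticalCorr 3) ρ S → (∀ n z, z ∉ NonCoincident 3 n → S n z = 0) →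
        IsNondegenerateTwoPoint S → IsEuclideanInvariant S → IsScaleCovariant Δ S →
        ∀ n, Literature.Probability.LatticeModels.SCTWardWeak S Δ n) :=
  inversionPositiveLimit_iff_inversionUpgradeNormalised.trans
    Summit.CriticalPhenomena.Ising3DConformalLimit.MoebiusLimitExistsWardDoor.inversionUpgradeNormalised_iff_wardUpgrade

/-- **Fourth reading of what remains (c6): the LATTICE Ward door.** The crux is equivalent to the asymptotic weak
special-conformal Ward identities of the rescaled LATTICE correlators: for every renormalisation `ρ > 0` on `(0,1]`
and every `Δ` under which `criticalCorr 3` HAS a normalised, non-degenerate, Euclidean-invariant, `Δ`-scale-covariant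
pointwise limit, and for every level `n`, generator `b` and smooth test function `φ` compactly supported inside
`NonCoincident 3 n`, `∫ ρ(δ)ⁿ ⟨σ_[x₁/δ] ⋯ σ_[xₙ/δ]⟩⁺_{β_c} (𝒦ᵀ_b φ)(x) dx → 0` as `δ → 0⁺` (`sctTestOp Δ n b φ` is the
adjoint special-conformal operator applied to `φ`).  By `crux_iff_stub` and the landed lattice Ward door
`MoebiusLimitExistsLatticeWard.inversionUpgradeNormalised_iff_latticeWardUpgrade'` (p152646).  No limit object occurs on
the right-hand side: this is the statement a discrete conformal Ward identity on `ℤ³` would have to prove.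
[cite: FrancescoMathieuSenechal1997, §4.3.1 eq. (4.62)] -/
theorem crux_iff_latticeWardUpgrade :
    Summit.CriticalPhenomena.Ising3DConformalLimit.Theses.PositivityBegetsConformality.InversionPositiveLimit ↔
      ∀ (ρ : ℝ → ℝ) (Δ : ℝ), (∀ δ ∈ Set.Ioc (0:ℝ) 1, 0 < ρ δ) →
        (∃ S : CorrFamily 3, HasPointwiseScalingLimit (criticalCorr 3) ρ S ∧
          (∀ n z, z ∉ NonCoincident 3 n → S n z = 0) ∧ IsNondegenerateTwoPoint S ∧ IsEuclideanInvariant S ∧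
          IsScaleCovariant Δ S) →
        ∀ (n : ℕ) (b : EuclideanSpace ℝ (Fin 3)) (φ : (Fin n → EuclideanSpace ℝ (Fin 3)) → ℝ),
          ContDiff ℝ ((⊤ : ℕ∞) : WithTop ℕ∞) φ → HasCompactSupport φ → tsupport φ ⊆ NonCoincident 3 n →
            Tendsto (fun δ => MeasureTheory.integral MeasureTheory.volume
                (fun x => rescaledCorrelator (criticalCorr 3) ρ n δ x * sctTestOp Δ n b φ x))
              (𝓝[>] (0:ℝ)) (𝓝 0) :=
  inversionPositiveLimit_iff_inversionUpgradeNormalised.trans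
    Summit.CriticalPhenomena.Ising3DConformalLimit.MoebiusLimitExistsLatticeWard.inversionUpgradeNormalised_iff_latticeWardUpgrade'

/-- **Fifth reading (c6): the crux is an `∃`-statement.** `InversionPositiveLimit` ⟺ (item 1981, route spelling
`ExistsScaleCovariantLimit` ⇒ SOME admissible `(ρ, Δ, S)` is inversion positive): ONE inversion-positive admissible
scaling limit of `criticalCorr 3` under ANY renormalisation closes the crux for all — the landed
`InversionPositiveLimitWitness.inversionPositiveLimit_iff_exists` (p154188; transport of `IsInversionPositive` along the
`cⁿ`-orbit of non-degenerate limits, `delta_unique`). [folklore] -/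
theorem crux_iff_exists :
    Summit.CriticalPhenomena.Ising3DConformalLimit.Theses.PositivityBegetsConformality.InversionPositiveLimit ↔
      (Summit.CriticalPhenomena.Ising3DConformalLimit.Theses.PositivityBegetsConformality.ExistsScaleCovariantLimit →
        ∃ (ρ : ℝ → ℝ) (Δ : ℝ) (S : CorrFamily 3), (∀ δ ∈ Set.Ioc (0:ℝ) 1, 0 < ρ δ) ∧
          HasPointwiseScalingLimit (criticalCorr 3) ρ S ∧ (∀ n z, z ∉ NonCoincident 3 n → S n z = 0) ∧
          IsNondegenerateTwoPoint S ∧ IsTranslationInvariant S ∧ IsScaleCovariant Δ S ∧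
          IsInversionPositive Δ S) :=
  Summit.CriticalPhenomena.Ising3DConformalLimit.InversionPositiveLimitWitness.inversionPositiveLimit_iff_exists

/-- **The stub suffices through ONE witness** (c6): given item 1982 restricted to a single admissible triple
`(ρ₀, Δ₀, S₀)` — i.e. inversion covariance of that one limit — the crux follows for all admissible triples
(`isInversionPositive_of_limit` at the witness, then `inversionPositiveLimit_iff_of_witness`). [folklore] -/
theorem InversionPositiveLimit_of_covariant_witness {ρ₀ : ℝ → ℝ} {Δ₀ : ℝ} {S₀ : CorrFamily 3}
    (hρ₀ : ∀ δ ∈ Set.Ioc (0:ℝ) 1, 0 < ρ₀ δ) (hlim₀ : HasPointwiseScalingLimit (criticalCorr 3) ρ₀ S₀)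
    (hnorm₀ : ∀ n z, z ∉ NonCoincident 3 n → S₀ n z = 0) (hnd₀ : IsNondegenerateTwoPoint S₀)
    (htr₀ : IsTranslationInvariant S₀) (hsc₀ : IsScaleCovariant Δ₀ S₀) (hinv₀ : IsInversionCovariant Δ₀ S₀) :
    Summit.CriticalPhenomena.Ising3DConformalLimit.Theses.PositivityBegetsConformality.InversionPositiveLimit :=
  (Summit.CriticalPhenomena.Ising3DConformalLimit.InversionPositiveLimitWitness.inversionPositiveLimit_iff_of_witness
      hρ₀ hlim₀ hnorm₀ hnd₀ htr₀ hsc₀).2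
    (isInversionPositive_of_limit hρ₀ hlim₀ hnorm₀ hnd₀ htr₀ hsc₀ hinv₀)

/-- **Sixth reading (c6): the crux's first level with content.** The crux implies item stmt-4672
(`fourPointConeMembership_of_inversionPositiveLimit`, p148112), and item 4672 is EXACTLY the level-4 inversion
upgrade of admissible limits (`InversionPositiveLimitLevelFour.fourPointConeMembership_iff_levelFour`, p155847);
hence the crux yields inversion covariance of the four-point function of every admissible limit — the `n = 4`
instance of STUB 1, isolated as the route's independently attackable / refutable rank-3 crux. [folklore] -/
theorem crux_levelFour
    (h : Summit.CriticalPhenomena.Ising3DConformalLimit.Theses.PositivityBegetsConformality.InversionPositiveLimit) :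
    ∀ (ρ : ℝ → ℝ) (Δ : ℝ) (S : CorrFamily 3), (∀ δ ∈ Set.Ioc (0:ℝ) 1, 0 < ρ δ) →
      HasPointwiseScalingLimit (criticalCorr 3) ρ S → (∀ n z, z ∉ NonCoincident 3 n → S n z = 0) →
      IsNondegenerateTwoPoint S → IsTranslationInvariant S → IsScaleCovariant Δ S →
      ∀ x : Fin 4 → EuclideanSpace ℝ (Fin 3), (∀ i, x i ≠ 0) →
        S 4 (fun i => inversion 0 1 (x i)) = (∏ i, ‖x i‖ ^ (2 * Δ)) * S 4 x :=
  Summit.CriticalPhenomena.Ising3DConformalLimit.InversionPositiveLimitLevelFour.fourPointConeMembership_iff_levelFour.1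
    (Summit.CriticalPhenomena.Ising3DConformalLimit.PositivityBegetsConformalityInversionPositiveLimit.fourPointConeMembership_of_inversionPositiveLimit
      h)

/-! ## The former STUB 2 (lattice radial OS positivity), discharged modulo STUB 1 -/

/-- **The cone is closed along the mesh filter.** The radial OS quadratic form of the rescaled
lattice correlators converges, as `δ → 0⁺`, to that of the limit `S` (admissible juxtapositions are
non-coincident, `append_inversion_mem_nonCoincident`; finite sums of limits). [folklore] -/
theorem tendsto_latticeForm {ρ : ℝ → ℝ} (Δ : ℝ) {S : CorrFamily 3}
    (hlim : HasPointwiseScalingLimit (criticalCorr 3) ρ S)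
    {m : ℕ} {k : Fin m → ℕ} {X : (a : Fin m) → Fin (k a) → EuclideanSpace ℝ (Fin 3)}
    (hX : ∀ a i, X a i ≠ 0 ∧ ‖X a i‖ < 1) (hinj : ∀ a, Function.Injective (X a))
    (c : Fin m → ℝ) :
    Tendsto (fun δ => ∑ a, ∑ b, c a * c b * ((∏ i, ‖X b i‖ ^ (-(2 * Δ))) *
        rescaledCorrelator (criticalCorr 3) ρ (k a + k b) δ
          (Fin.append (X a) (fun i => inversion 0 1 (X b i)))))
      (𝓝[>] (0:ℝ))
      (𝓝 (∑ a, ∑ b, c a * c b * ((∏ i, ‖X b i‖ ^ (-(2 * Δ))) *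
        S (k a + k b) (Fin.append (X a) (fun i => inversion 0 1 (X b i)))))) := by
  refine tendsto_finsetSum _ fun a _ => tendsto_finsetSum _ fun b _ => ?_
  exact (((hlim (k a + k b)).tendsto_at
    (append_inversion_mem_nonCoincident hX hinj a b)).const_mul _).const_mul _

/-- crux ⇒ former STUB 2: the limit form is `≥ 0` (`IsInversionPositive.sum_mul_inversionGram_nonneg`)
and the lattice form converges to it (`tendsto_latticeForm`), so it is eventually `≥ −ε`. [folklore] -/
theorem latticeRadialPositivity_of_crux
    (h : Summit.CriticalPhenomena.Ising3DConformalLimit.Theses.PositivityBegetsConformality.InversionPositiveLimit) :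
    ∀ (ρ : ℝ → ℝ) (Δ : ℝ) (S : Literature.Probability.LatticeModels.CorrFamily 3),
      (∀ δ ∈ Set.Ioc (0:ℝ) 1, 0 < ρ δ) →
      Literature.Probability.LatticeModels.HasPointwiseScalingLimit
        (Literature.Probability.LatticeModels.criticalCorr 3) ρ S →
      (∀ n z, z ∉ Literature.Probability.LatticeModels.NonCoincident 3 n → S n z = 0) →
      Literature.Probability.LatticeModels.IsNondegenerateTwoPoint S →
      Literature.Probability.LatticeModels.IsTranslationInvariant S →
      Literature.Probability.LatticeModels.IsScaleCovariant Δ S →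
      ∀ (m : ℕ) (k : Fin m → ℕ) (X : (a : Fin m) → Fin (k a) → EuclideanSpace ℝ (Fin 3)),
        (∀ a i, X a i ≠ 0 ∧ ‖X a i‖ < 1) → (∀ a, Function.Injective (X a)) →
        ∀ (c : Fin m → ℝ) (ε : ℝ), 0 < ε →
          ∀ᶠ δ in nhdsWithin (0:ℝ) (Set.Ioi 0),
            -ε ≤ ∑ a, ∑ b, c a * c b * ((∏ i, ‖X b i‖ ^ (-(2 * Δ))) *
              Literature.Probability.LatticeModels.rescaledCorrelator
                (Literature.Probability.LatticeModels.criticalCorr 3) ρ (k a + k b) δ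
                (Fin.append (X a) (fun i => EuclideanGeometry.inversion 0 1 (X b i)))) := by
  intro ρ Δ S hρ hlim hnorm hnd htr hsc m k X hX hinj c ε hε
  have hIP : IsInversionPositive Δ S := h ρ Δ S hρ hlim hnorm hnd htr hsc
  have h0 : 0 ≤ ∑ a, ∑ b, c a * c b * ((∏ i, ‖X b i‖ ^ (-(2 * Δ))) *
      S (k a + k b) (Fin.append (X a) (fun i => inversion 0 1 (X b i)))) := by
    have h1 := hIP.sum_mul_inversionGram_nonneg hX hinj c
    simpa only [inversionGram_apply] using h1
  have ht := tendsto_latticeForm Δ hlim hX hinj c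
  have hev := ht.eventually (Ioi_mem_nhds (show (∑ a, ∑ b, c a * c b * ((∏ i, ‖X b i‖ ^ (-(2 * Δ))) *
      S (k a + k b) (Fin.append (X a) (fun i => inversion 0 1 (X b i))))) - ε <
      ∑ a, ∑ b, c a * c b * ((∏ i, ‖X b i‖ ^ (-(2 * Δ))) *
        S (k a + k b) (Fin.append (X a) (fun i => inversion 0 1 (X b i)))) by linarith))
  filter_upwards [hev] with δ hδ
  linarith

/-- **Former STUB 2 discharged modulo STUB 1**: lattice radial OS positivity (the birth certificate's
`stub_latticeRadialPositivity`, verbatim signature) follows from the inversion upgrade (item 1982) — by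
`InversionPositiveLimit_of` and `latticeRadialPositivity_of_crux`. [folklore] -/
theorem latticeRadialPositivity_of_stub
    (h₁ : Summit.CriticalPhenomena.Ising3DConformalLimit.Theses.HyperoctahedralRP.InversionUpgradeNormalised) :
    ∀ (ρ : ℝ → ℝ) (Δ : ℝ) (S : Literature.Probability.LatticeModels.CorrFamily 3),
      (∀ δ ∈ Set.Ioc (0:ℝ) 1, 0 < ρ δ) →
      Literature.Probability.LatticeModels.HasPointwiseScalingLimit
        (Literature.Probability.LatticeModels.criticalCorr 3) ρ S →
      (∀ n z, z ∉ Literature.Probability.LatticeModels.NonCoincident 3 n → S n z = 0) →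
      Literature.Probability.LatticeModels.IsNondegenerateTwoPoint S →
      Literature.Probability.LatticeModels.IsTranslationInvariant S →
      Literature.Probability.LatticeModels.IsScaleCovariant Δ S →
      ∀ (m : ℕ) (k : Fin m → ℕ) (X : (a : Fin m) → Fin (k a) → EuclideanSpace ℝ (Fin 3)),
        (∀ a i, X a i ≠ 0 ∧ ‖X a i‖ < 1) → (∀ a, Function.Injective (X a)) →
        ∀ (c : Fin m → ℝ) (ε : ℝ), 0 < ε →
          ∀ᶠ δ in nhdsWithin (0:ℝ) (Set.Ioi 0),
            -ε ≤ ∑ a, ∑ b, c a * c b * ((∏ i, ‖X b i‖ ^ (-(2 * Δ))) *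
              Literature.Probability.LatticeModels.rescaledCorrelator
                (Literature.Probability.LatticeModels.criticalCorr 3) ρ (k a + k b) δ
                (Fin.append (X a) (fun i => EuclideanGeometry.inversion 0 1 (X b i)))) :=
  latticeRadialPositivity_of_crux (InversionPositiveLimit_of_stub1 h₁)

end Summit.CriticalPhenomena.Ising3DConformalLimit.Cruxes.InversionPositiveLimit.Birth

end
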